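import Literature.Probability.RandomPlanarGeometry.LoewnerImageFlow
import HarnessLib

/-!
# The conformal image of a Loewner chain: continuity in time of `W̃_t` and `g̃_t(ζ)`, and the Loewner equation (5.1) as a two-sided derivative

Sequel of `LoewnerImageFlow` ([LSW] 2003 §5: `W̃_t = h_t(W_t)`, `g̃_t = h_t ∘ g_t ∘ Φ_A⁻¹`,
`∂_t g̃_t(z) = 2 h_t'(W_t)²/(g̃_t(z) − W̃_t)` (5.1); G. F. Lawler (2005), §4.6.1 Prop. 4.40–4.41,
(4.34)). For a continuous driving function `W`, a nonempty `*`-hull `A` and the set of ALIVE times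
`{t | Disjoint (closedHull W t) A}` (an interval `[0, T_A)`, `LoewnerAliveMargin`) we PROVE:

* `continuousWithinAt_imageDriver` — **`t ↦ W̃_t` is continuous** within the alive times (the
  one-step bound `|W̃_{b+u} − W̃_b| ≤ 25u/ρ + 2|W_{b+u} − W_b|` run forward from the base `b = s`
  and forward from the base `b = v < s`, whose control constants are uniform near `s` by the local
  tube of `RestrictionDerivTime` and `exists_forall_starDeriv_ge_half`);
* `continuousWithinAt_imageFlow` — **`t ↦ g̃_t(ζ)` is continuous** within the alive times, for
  `z ∈ ℍ ∖ A` alive at `s` (`‖g̃_{b+u}(ζ) − g̃_b(ζ)‖ ≤ 20u/|g̃_b(ζ) − W̃_b|`, where for `b = v < s`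
  the denominator is bounded below by `Im g̃_s(ζ)` because the image flow lowers imaginary parts,
  `im_imageFlow_add_le`).

* `im_imageFlow_sub_imageDriver_pos` — `g̃_t(ζ) − W̃_t ∈ ℍ`;
* **`hasDerivAt_imageFlow`** — **[LSW] (5.1) as a two-sided derivative**:
  `∂_t g̃_t(ζ) = 2 d_t²/(g̃_t(ζ) − W̃_t)` at every `t ∈ (0, β)`, `β` alive, `z ∈ ℍ ∖ A` alive at `β`
  — from the right derivative of `LoewnerImageFlow.hasDerivWithinAt_imageFlow_Ici`, the continuity
  of `t ↦ g̃_t(ζ)` and of the right derivative (this file and `continuousWithinAt_starDeriv_slidHull`)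
  and the fundamental theorem of calculus for right derivatives
  (`intervalIntegral.integral_eq_sub_of_hasDeriv_right_of_le`).

The identification of `g̃` with the Loewner chain of `W̃` in the clock `∫ d²` is the sequel. No
named fact, no definition.

## References

* [LSW] 2003, §5 (W̃, g̃, (5.1)). [LawlerSchrammWerner2003Restriction]
* G. F. Lawler (2005), §4.6.1; Lemma 4.13. [Lawler2005]
-/

noncomputable section

open Set Filter Metric Bornology Function
open _root_.Complex _root_.Topology _root_.Real
open UpperHalfPlane (upperHalfPlaneSet isOpen_upperHalfPlaneSet)
open scoped ComplexConjugate NNReal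

namespace Literature.Probability.RandomPlanarGeometry

namespace Loewner

variable {W : ℝ≥0 → ℝ} {A : Set ℂ}

/-! ### Splitting a nearby time into base and step -/

/-- For `v ≥ s`: `v = s + (v - s)` in `ℝ≥0`, with `((v - s : ℝ≥0) : ℝ) = v - s`. [folklore] -/
theorem eq_add_tsub_of_le {s v : ℝ≥0} (h : s ≤ v) : v = s + (v - s) ∧ ((v - s : ℝ≥0) : ℝ) = (v : ℝ) - s :=
  ⟨(add_tsub_cancel_of_le h).symm, NNReal.coe_sub h⟩

/-! ### Continuity of the image driving function -/

/-- **`t ↦ W̃_t = h_t(W_t)` is continuous on the alive times** ([LSW] §5). Quantitatively: for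
alive `v` near the alive time `s`, `|W̃_v − W̃_s| ≤ 25|v − s|/ρ + 4 osc_{[s∧v, s∨v]} W`, `16ρ = dist(0, B_s)`.
[cite: LawlerSchrammWerner2003Restriction, §5 (W̃_t continuous)] -/
theorem continuousWithinAt_imageDriver (hW : Continuous W) (hA : IsStarHull A) (hne : A.Nonempty)
    {s : ℝ≥0} (hs : Disjoint (closedHull W s) A) :
    ContinuousWithinAt (fun v : ℝ≥0 ↦ imageDriver W A v) {v | Disjoint (closedHull W v) A} s := by
  have hBs := isStarHull_slidHull_of_disjoint hW hA hs
  obtain ⟨hd0, hd1, -⟩ := starDeriv_spec hBs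
  set d : ℝ := starDeriv (slidHull W A s) with hddef
  obtain ⟨ρ, hρ, hρm, htube⟩ := exists_tube_at hW hA hne hs
  obtain ⟨δh, hδh, hhalf⟩ := exists_forall_starDeriv_ge_half hW hA hne hs
  rw [Metric.continuousWithinAt_iff]
  intro ε hε
  -- oscillation threshold `ω` and time window `δ`
  set ω : ℝ := min (ε / 8) (d * ρ / 8000) with hω
  have hω0 : 0 < ω := lt_min (by positivity) (by positivity)
  have hω1 : ω ≤ ε / 8 := min_le_left _ _
  have hω2 : ω ≤ d * ρ / 8000 := min_le_right _ _
  obtain ⟨δt, hδt, htubev⟩ := htube ω hω0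
  set δ : ℝ := min δt (min δh (min ((ρ / 4) ^ 2) (min ((d * ρ / 16000) ^ 2) (ε * ρ / 50)))) with hδ
  have hδ0 : 0 < δ := lt_min hδt (lt_min hδh (lt_min (by positivity) (lt_min (by positivity) (by positivity))))
  have hδ_t : δ ≤ δt := min_le_left _ _
  have hδ_h : δ ≤ δh := (min_le_right _ _).trans (min_le_left _ _)
  have hδ_ρ : δ ≤ (ρ / 4) ^ 2 := (min_le_right _ _).trans ((min_le_right _ _).trans (min_le_left _ _))
  have hδ_d : δ ≤ (d * ρ / 16000) ^ 2 :=
    (min_le_right _ _).trans ((min_le_right _ _).trans ((min_le_right _ _).trans (min_le_left _ _)))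
  have hδ_ε : δ ≤ ε * ρ / 50 :=
    (min_le_right _ _).trans ((min_le_right _ _).trans ((min_le_right _ _).trans (min_le_right _ _)))
  refine ⟨δ, hδ0, fun v hv hvs ↦ ?_⟩
  have hv' : Disjoint (closedHull W v) A := hv
  rw [NNReal.dist_eq] at hvs
  obtain ⟨hpt, hBρv, hosc⟩ := htubev v hv' (hvs.le.trans hδ_t)
  have hdv : d / 2 ≤ starDeriv (slidHull W A v) := hhalf v hv' (hvs.le.trans hδ_h)
  -- `4√δ ≤ dρ/4000`
  have hsqrt : 4 * Real.sqrt δ ≤ d * ρ / 4000 := by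
    have : Real.sqrt δ ≤ d * ρ / 16000 := by rw [Real.sqrt_le_left (by positivity)]; exact hδ_d
    linarith
  rw [Real.dist_eq]
  rcases le_or_gt s v with hsv | hvs'
  · -- forward from the base `s`
    obtain ⟨hveq, hucoe⟩ := eq_add_tsub_of_le hsv
    set u : ℝ≥0 := v - s with hudef
    have hu_abs : (u : ℝ) = |(v : ℝ) - s| := by rw [hucoe, abs_of_nonneg (by simpa using hsv)]
    rcases eq_or_lt_of_le (show (0 : ℝ≥0) ≤ u from bot_le) with hu0 | hu0
    · have : v = s := by rw [hveq, ← hu0, add_zero]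
      rw [this, sub_self, abs_zero]; exact hε
    have huδ : (u : ℝ) < δ := by rw [hu_abs]; exact hvs
    have hS : ∀ r : ℝ≥0, r ≤ u → |W (s + r) - W s| ≤ ω := by
      intro r hr
      refine hosc (s + r) (by rw [min_eq_left hsv]; exact le_self_add) ?_
      rw [max_eq_right hsv, hveq]; gcongr
    have h4u : 4 * Real.sqrt u ≤ d * ρ / 4000 :=
      (mul_le_mul_of_nonneg_left (Real.sqrt_le_sqrt huδ.le) (by norm_num)).trans hsqrt
    have hdρ : d * ρ ≤ ρ := mul_le_of_le_one_left hρ.le hd1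
    have hη : stepSize ω u ≤ ρ := by rw [stepSize]; linarith
    have hu4 : (u : ℝ) ≤ (ρ / 4) ^ 2 := huδ.le.trans hδ_ρ
    have hBρs : Disjoint (ball (0 : ℂ) (8 * ρ)) (slidHull W A s) := by
      obtain ⟨-, h, -⟩ := htubev s hs (by simp [hδt.le]); exact h
    have hη' : stepSize ω u ≤ starDeriv (slidHull W A s) * ρ / 1000 := by
      rw [stepSize, ← hddef]; linarith
    have key := abs_imageDriver_add_sub_le hW hA hs hρ hBρs hu0 hS hη hu4 hη'
    rw [← hveq] at key
    have hW1 : |W v - W s| ≤ ω := hosc v (by rw [min_eq_left hsv]; exact hsv) (by rw [max_eq_right hsv])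
    calc |imageDriver W A v - imageDriver W A s| ≤ 25 * u / ρ + 2 * |W v - W s| := key
      _ < ε := by
          have h1 : 25 * (u : ℝ) / ρ ≤ 25 * δ / ρ := by gcongr
          have h2 : 25 * δ / ρ ≤ ε / 2 := by rw [div_le_iff₀ hρ]; linarith
          linarith
  · -- forward from the base `v < s`
    obtain ⟨hseq, hucoe⟩ := eq_add_tsub_of_le hvs'.le
    set u : ℝ≥0 := s - v with hudef
    have hu_abs : (u : ℝ) = |(v : ℝ) - s| := by
      rw [hucoe, abs_sub_comm, abs_of_nonneg (by simpa using hvs'.le)]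
    have hu0 : 0 < u := by simpa [hudef] using hvs'
    have huδ : (u : ℝ) < δ := by rw [hu_abs]; exact hvs
    have hBv := isStarHull_slidHull_of_disjoint hW hA hv'
    have hS : ∀ r : ℝ≥0, r ≤ u → |W (v + r) - W v| ≤ 2 * ω := by
      intro r hr
      have h1 : |W (v + r) - W s| ≤ ω := by
        refine hosc (v + r) (by rw [min_eq_right hvs'.le]; exact le_self_add) ?_
        rw [max_eq_left hvs'.le, hseq]; gcongr
      have h2 : |W v - W s| ≤ ω := hosc v (by rw [min_eq_right hvs'.le]) (by rw [max_eq_left hvs'.le]; exact hvs'.le)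
      calc |W (v + r) - W v| = |(W (v + r) - W s) - (W v - W s)| := by ring_nf
        _ ≤ |W (v + r) - W s| + |W v - W s| := abs_sub _ _
        _ ≤ 2 * ω := by linarith
    have h4u : 4 * Real.sqrt u ≤ d * ρ / 4000 :=
      (mul_le_mul_of_nonneg_left (Real.sqrt_le_sqrt huδ.le) (by norm_num)).trans hsqrt
    have hdρ : d * ρ ≤ ρ := mul_le_of_le_one_left hρ.le hd1
    have hη : stepSize (2 * ω) u ≤ ρ := by rw [stepSize]; linarith
    have hu4 : (u : ℝ) ≤ (ρ / 4) ^ 2 := huδ.le.trans hδ_ρ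
    have hη' : stepSize (2 * ω) u ≤ starDeriv (slidHull W A v) * ρ / 1000 := by
      rw [stepSize]
      have : d * ρ / 2000 ≤ starDeriv (slidHull W A v) * ρ / 1000 := by
        rw [div_le_div_iff₀ (by norm_num) (by norm_num)]; nlinarith
      linarith
    have key := abs_imageDriver_add_sub_le hW hA hv' hρ hBρv hu0 hS hη hu4 hη'
    rw [← hseq] at key
    have hW1 : |W s - W v| ≤ ω := by
      rw [abs_sub_comm]
      exact hosc v (by rw [min_eq_right hvs'.le]) (by rw [max_eq_left hvs'.le]; exact hvs'.le)
    rw [abs_sub_comm]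
    calc |imageDriver W A s - imageDriver W A v| ≤ 25 * u / ρ + 2 * |W s - W v| := key
      _ < ε := by
          have h1 : 25 * (u : ℝ) / ρ ≤ 25 * δ / ρ := by gcongr
          have h2 : 25 * δ / ρ ≤ ε / 2 := by rw [div_le_iff₀ hρ]; linarith
          linarith

/-! ### Continuity of the image flow of a point -/

/-- **`t ↦ g̃_t(ζ)` is continuous on the alive times**, for `z ∈ ℍ ∖ A` alive at `s`
([LSW] §5; Lawler (2005), Prop. 4.40). Quantitatively: for alive `v` near `s`,
`‖g̃_v(ζ) − g̃_s(ζ)‖ ≤ 20 |v − s| / Im g̃_s(ζ)` (forward from the base `s ∧ v`; when the base is `v < s`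
the denominator `|g̃_v(ζ) − W̃_v| ≥ Im g̃_v(ζ) ≥ Im g̃_s(ζ)` because the image flow lowers imaginary
parts). [cite: LawlerSchrammWerner2003Restriction, §5 (g̃_t); Lawler2005, Prop. 4.40] -/
theorem continuousWithinAt_imageFlow (hW : Continuous W) (hA : IsStarHull A) (hne : A.Nonempty)
    {s : ℝ≥0} (hs : Disjoint (closedHull W s) A) {z : ℂ} (hzH : 0 < z.im) (hzA : z ∉ A)
    (hz : (s : WithTop ℝ≥0) < swallowingTime W z) :
    ContinuousWithinAt (fun v : ℝ≥0 ↦ imageFlow W A v z) {v | Disjoint (closedHull W v) A} s := by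
  have hBs := isStarHull_slidHull_of_disjoint hW hA hs
  obtain ⟨hd0, hd1, -⟩ := starDeriv_spec hBs
  set d : ℝ := starDeriv (slidHull W A s) with hddef
  obtain ⟨ρ, hρ, hρm, htube⟩ := exists_tube_at hW hA hne hs
  obtain ⟨δh, hδh, hhalf⟩ := exists_forall_starDeriv_ge_half hW hA hne hs
  -- `E_s = g̃_s(ζ) − W̃_s ∈ ℍ`: `ι = Im E_s > 0`, `ι ≤ ‖E_s‖`
  set E : ℂ := imageFlow W A s z - imageDriver W A s with hEdef
  have hzdom : z ∈ domain W s := (mem_domain_iff W s z).2 ⟨hzH, hz⟩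
  have hyH : 0 < (map W s z - W s).im := by
    rw [sub_im, ofReal_im, sub_zero]; exact mapsTo_map hW s hzdom
  have hyB : map W s z - W s ∉ slidHull W A s := by
    rintro ⟨a, ha, hae⟩
    have haalive := lt_swallowingTime_of_alive hA hs ha
    have heq : map W s a = map W s z := by
      have := congrArg (· + (W s : ℂ)) hae; simpa using this
    have haim : 0 ≤ a.im := by
      have := hA.isBoundedHull.subset_closure ha
      rwa [show upperHalfPlaneSet = {z : ℂ | 0 < z.im} from rfl, Complex.closure_setOf_lt_im] at this
    rcases haim.lt_or_eq with hapos | hazero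
    · have hadom : a ∈ domain W s := (mem_domain_iff W s a).2 ⟨hapos, haalive⟩
      exact hzA ((injOn_map hW s hadom hzdom heq) ▸ ha)
    · have ha' : a = (((a.re : ℝ)) : ℂ) := Complex.ext rfl (by rw [ofReal_im]; exact hazero.symm)
      rw [ha'] at haalive heq
      have hreal : (map W s (a.re : ℝ)).im = 0 := map_ofReal_im hW haalive
      rw [heq] at hreal
      exact absurd hreal (ne_of_gt (mapsTo_map hW s hzdom))
  set ι : ℝ := E.im with hιdef
  have hιE : ι = (imageFlow W A s z).im := by
    rw [hιdef, hEdef, sub_im, ofReal_im, sub_zero]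
  have hι0 : 0 < ι := by
    rw [hιdef, hEdef, imageFlow_sub_imageDriver, starMap_eq hBs]
    exact hullExt_im_pos (Φ := starRMap _ hBs) ⟨hyH, hyB⟩
  have hιle : ι ≤ ‖E‖ := by rw [hιdef]; exact (abs_im_le_norm E).trans' (le_abs_self _)
  have hE0 : 0 < ‖E‖ := hι0.trans_le hιle
  -- a margin in time for the aliveness of `z`
  obtain ⟨δ₂, hδ₂, halive⟩ : ∃ δ₂ : ℝ, 0 < δ₂ ∧ ∀ u : ℝ≥0, (u : ℝ) < δ₂ →
      ((s + u : ℝ≥0) : WithTop ℝ≥0) < swallowingTime W z := by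
    induction hT : swallowingTime W z with
    | top => exact ⟨1, one_pos, fun u _ ↦ WithTop.coe_lt_top _⟩
    | coe b =>
      rw [hT] at hz
      have hsb : s < b := WithTop.coe_lt_coe.1 hz
      refine ⟨(b : ℝ) - s, by simpa using hsb, fun u hu ↦ WithTop.coe_lt_coe.2 ?_⟩
      rw [← NNReal.coe_lt_coe, NNReal.coe_add]; linarith
  rw [Metric.continuousWithinAt_iff]
  intro ε hε
  -- the smallness constant `c` for `η`, the oscillation threshold `ω = c/4`, the window `δ`
  set c : ℝ := min (d ^ 2 * ρ / 8000) (ι / 4) with hc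
  have hc0 : 0 < c := lt_min (by positivity) (by positivity)
  have hc1 : c ≤ d ^ 2 * ρ / 8000 := min_le_left _ _
  have hc2 : c ≤ ι / 4 := min_le_right _ _
  obtain ⟨δt, hδt, htubev⟩ := htube (c / 4) (by positivity)
  set δ : ℝ := min δt (min δh (min ((ρ / 4) ^ 2) (min ((c / 8) ^ 2) (min (ε * ι / 40) (δ₂ / 2))))) with hδ
  have hδ0 : 0 < δ := lt_min hδt (lt_min hδh (lt_min (by positivity) (lt_min (by positivity)
    (lt_min (by positivity) (by positivity)))))
  have hδ_t : δ ≤ δt := min_le_left _ _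
  have hδ_h : δ ≤ δh := (min_le_right _ _).trans (min_le_left _ _)
  have hδ_ρ : δ ≤ (ρ / 4) ^ 2 := (min_le_right _ _).trans ((min_le_right _ _).trans (min_le_left _ _))
  have hδ_c : δ ≤ (c / 8) ^ 2 :=
    (min_le_right _ _).trans ((min_le_right _ _).trans ((min_le_right _ _).trans (min_le_left _ _)))
  have hδ_ε : δ ≤ ε * ι / 40 :=
    (min_le_right _ _).trans ((min_le_right _ _).trans ((min_le_right _ _).trans ((min_le_right _ _).trans (min_le_left _ _))))
  have hδ_2 : δ ≤ δ₂ / 2 :=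
    (min_le_right _ _).trans ((min_le_right _ _).trans ((min_le_right _ _).trans ((min_le_right _ _).trans (min_le_right _ _))))
  refine ⟨δ, hδ0, fun v hv hvs ↦ ?_⟩
  have hv' : Disjoint (closedHull W v) A := hv
  rw [NNReal.dist_eq] at hvs
  obtain ⟨-, hBρv, hosc⟩ := htubev v hv' (hvs.le.trans hδ_t)
  have hdv : d / 2 ≤ starDeriv (slidHull W A v) := hhalf v hv' (hvs.le.trans hδ_h)
  have hsqrt : 4 * Real.sqrt δ ≤ c / 2 := by
    have : Real.sqrt δ ≤ c / 8 := by rw [Real.sqrt_le_left (by positivity)]; exact hδ_c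
    linarith
  have hd2 : d ^ 2 ≤ d := by nlinarith
  have hcρ : c ≤ ρ := hc1.trans (by
    rw [div_le_iff₀ (by norm_num : (0 : ℝ) < 8000)]
    have e1 : d ^ 2 * ρ ≤ 1 * ρ := mul_le_mul_of_nonneg_right (hd2.trans hd1) hρ.le
    linarith)
  rw [dist_eq_norm]
  rcases le_or_gt s v with hsv | hvs'
  · -- forward from the base `s`
    obtain ⟨hveq, hucoe⟩ := eq_add_tsub_of_le hsv
    set u : ℝ≥0 := v - s with hudef
    have hu_abs : (u : ℝ) = |(v : ℝ) - s| := by rw [hucoe, abs_of_nonneg (by simpa using hsv)]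
    rcases eq_or_lt_of_le (show (0 : ℝ≥0) ≤ u from bot_le) with hu0 | hu0
    · have : v = s := by rw [hveq, ← hu0, add_zero]
      rw [this, sub_self, norm_zero]; exact hε
    have huδ : (u : ℝ) < δ := by rw [hu_abs]; exact hvs
    have hS : ∀ r : ℝ≥0, r ≤ u → |W (s + r) - W s| ≤ c / 4 := by
      intro r hr
      refine hosc (s + r) (by rw [min_eq_left hsv]; exact le_self_add) ?_
      rw [max_eq_right hsv, hveq]; gcongr
    have h4u : 4 * Real.sqrt u ≤ c / 2 := (mul_le_mul_of_nonneg_left (Real.sqrt_le_sqrt huδ.le) (by norm_num)).trans hsqrt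
    have hηc : stepSize (c / 4) u ≤ c := by rw [stepSize]; linarith
    have hη : stepSize (c / 4) u ≤ ρ := hηc.trans hcρ
    have hu4 : (u : ℝ) ≤ (ρ / 4) ^ 2 := huδ.le.trans hδ_ρ
    have hBρs : Disjoint (ball (0 : ℂ) (8 * ρ)) (slidHull W A s) := by
      obtain ⟨-, h, -⟩ := htubev s hs (by simp [hδt.le]); exact h
    have hη2 : stepSize (c / 4) u ≤ starDeriv (slidHull W A s) ^ 2 * ρ / 2000 := by
      rw [← hddef]
      refine hηc.trans (hc1.trans ?_)
      rw [div_le_div_iff₀ (by norm_num) (by norm_num)]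
      have : 0 ≤ d ^ 2 * ρ := by positivity
      linarith
    have hEη : 4 * stepSize (c / 4) u ≤ ‖imageFlow W A s z - imageDriver W A s‖ := by
      change 4 * stepSize (c / 4) u ≤ ‖E‖; linarith
    have hzu : ((s + u : ℝ≥0) : WithTop ℝ≥0) < swallowingTime W z := halive u (by linarith [huδ, hδ_2, hδ₂])
    obtain ⟨-, key⟩ := norm_imageFlow_add_sub_sub_field_le hW hA hs hρ hBρs hu0 hS hη hu4 hη2 hzH hzA hzu hEη
    rw [← hveq] at key
    calc ‖imageFlow W A v z - imageFlow W A s z‖ ≤ 20 * u / ‖imageFlow W A s z - imageDriver W A s‖ := key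
      _ ≤ 20 * u / ι := by
          change 20 * (u : ℝ) / ‖E‖ ≤ 20 * u / ι
          exact div_le_div_of_nonneg_left (by positivity) hι0 hιle
      _ < ε := by
          rw [div_lt_iff₀ hι0]
          have h1 : 20 * δ ≤ ε * ι / 2 := by linarith [hδ_ε]
          have h2 : 0 < ε * ι := mul_pos hε hι0
          linarith [huδ]
  · -- forward from the base `v < s`
    obtain ⟨hseq, hucoe⟩ := eq_add_tsub_of_le hvs'.le
    set u : ℝ≥0 := s - v with hudef
    have hu_abs : (u : ℝ) = |(v : ℝ) - s| := by
      rw [hucoe, abs_sub_comm, abs_of_nonneg (by simpa using hvs'.le)]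
    have hu0 : 0 < u := by simpa [hudef] using hvs'
    have huδ : (u : ℝ) < δ := by rw [hu_abs]; exact hvs
    have hBv := isStarHull_slidHull_of_disjoint hW hA hv'
    obtain ⟨hdv0, hdv1, -⟩ := starDeriv_spec hBv
    have hS : ∀ r : ℝ≥0, r ≤ u → |W (v + r) - W v| ≤ c / 2 := by
      intro r hr
      have h1 : |W (v + r) - W s| ≤ c / 4 := by
        refine hosc (v + r) (by rw [min_eq_right hvs'.le]; exact le_self_add) ?_
        rw [max_eq_left hvs'.le, hseq]; gcongr
      have h2 : |W v - W s| ≤ c / 4 :=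
        hosc v (by rw [min_eq_right hvs'.le]) (by rw [max_eq_left hvs'.le]; exact hvs'.le)
      calc |W (v + r) - W v| = |(W (v + r) - W s) - (W v - W s)| := by ring_nf
        _ ≤ |W (v + r) - W s| + |W v - W s| := abs_sub _ _
        _ ≤ c / 2 := by linarith
    have h4u : 4 * Real.sqrt u ≤ c / 2 := (mul_le_mul_of_nonneg_left (Real.sqrt_le_sqrt huδ.le) (by norm_num)).trans hsqrt
    have hηc : stepSize (c / 2) u ≤ c := by rw [stepSize]; linarith
    have hη : stepSize (c / 2) u ≤ ρ := hηc.trans hcρ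
    have hu4 : (u : ℝ) ≤ (ρ / 4) ^ 2 := huδ.le.trans hδ_ρ
    have hη' : stepSize (c / 2) u ≤ starDeriv (slidHull W A v) * ρ / 1000 := by
      refine hηc.trans (hc1.trans ?_)
      rw [div_le_div_iff₀ (by norm_num) (by norm_num)]
      have e1 : d ^ 2 * ρ ≤ d * ρ := mul_le_mul_of_nonneg_right hd2 hρ.le
      have e2 : d * ρ ≤ 2 * starDeriv (slidHull W A v) * ρ := mul_le_mul_of_nonneg_right (by linarith) hρ.le
      have e3 : 0 ≤ starDeriv (slidHull W A v) * ρ := by positivity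
      linarith
    have hη2 : stepSize (c / 2) u ≤ starDeriv (slidHull W A v) ^ 2 * ρ / 2000 := by
      refine hηc.trans (hc1.trans ?_)
      rw [div_le_div_iff₀ (by norm_num) (by norm_num)]
      have h1 : (d / 2) ^ 2 ≤ starDeriv (slidHull W A v) ^ 2 := pow_le_pow_left₀ (by positivity) hdv 2
      have h2 : d ^ 2 = 4 * (d / 2) ^ 2 := by ring
      have h3 : d ^ 2 ≤ 4 * starDeriv (slidHull W A v) ^ 2 := by rw [h2]; linarith
      have h4 := mul_le_mul_of_nonneg_right h3 hρ.le
      linarith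
    have hzs : ((v + u : ℝ≥0) : WithTop ℝ≥0) < swallowingTime W z := by rw [← hseq]; exact hz
    -- the image flow lowers imaginary parts: `ι = Im g̃_s(ζ) ≤ Im g̃_v(ζ) ≤ ‖E_v‖`
    obtain ⟨-, him⟩ := im_imageFlow_add_le hW hA hv' hρ hBρv hu0 hS hη hu4 hη' hzH hzA hzs
    rw [← hseq] at him
    have hEv : ι ≤ ‖imageFlow W A v z - imageDriver W A v‖ := by
      have h1 : (imageFlow W A v z - imageDriver W A v).im = (imageFlow W A v z).im := by
        rw [sub_im, ofReal_im, sub_zero]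
      calc ι = (imageFlow W A s z).im := hιE
        _ ≤ (imageFlow W A v z).im := him
        _ = (imageFlow W A v z - imageDriver W A v).im := h1.symm
        _ ≤ ‖imageFlow W A v z - imageDriver W A v‖ := (abs_im_le_norm _).trans' (le_abs_self _)
    have hEη : 4 * stepSize (c / 2) u ≤ ‖imageFlow W A v z - imageDriver W A v‖ := by linarith
    obtain ⟨-, key⟩ := norm_imageFlow_add_sub_sub_field_le hW hA hv' hρ hBρv hu0 hS hη hu4 hη2 hzH hzA hzs hEη
    rw [← hseq] at key
    rw [norm_sub_rev]
    have hEvpos : 0 < ‖imageFlow W A v z - imageDriver W A v‖ := hι0.trans_le hEv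
    calc ‖imageFlow W A s z - imageFlow W A v z‖ ≤ 20 * u / ‖imageFlow W A v z - imageDriver W A v‖ := key
      _ ≤ 20 * u / ι := div_le_div_of_nonneg_left (by positivity) hι0 hEv
      _ < ε := by
          rw [div_lt_iff₀ hι0]
          have h1 : 20 * δ ≤ ε * ι / 2 := by linarith [hδ_ε]
          have h2 : 0 < ε * ι := mul_pos hε hι0
          linarith [huδ]

/-! ### `g̃_t(ζ) − W̃_t ∈ ℍ` -/

/-- **`Im (g̃_t(ζ) − W̃_t) > 0`** for `z ∈ ℍ ∖ A` alive at the alive time `t`: the slid point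
`g_t z − W_t` lies in `ℍ ∖ B_t` and `g̃_t(ζ) − W̃_t = E_{B_t}(g_t z − W_t) = Φ_{B_t}(g_t z − W_t) ∈ ℍ`.
[folklore] -/
theorem im_imageFlow_sub_imageDriver_pos (hW : Continuous W) (hA : IsStarHull A) {t : ℝ≥0}
    (ht : Disjoint (closedHull W t) A) {z : ℂ} (hzH : 0 < z.im) (hzA : z ∉ A)
    (hz : (t : WithTop ℝ≥0) < swallowingTime W z) :
    0 < (imageFlow W A t z - imageDriver W A t).im := by
  have hBt := isStarHull_slidHull_of_disjoint hW hA ht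
  have hzdom : z ∈ domain W t := (mem_domain_iff W t z).2 ⟨hzH, hz⟩
  have hyH : 0 < (map W t z - W t).im := by
    rw [sub_im, ofReal_im, sub_zero]; exact mapsTo_map hW t hzdom
  have hyB : map W t z - W t ∉ slidHull W A t := by
    rintro ⟨a, ha, hae⟩
    have haalive := lt_swallowingTime_of_alive hA ht ha
    have heq : map W t a = map W t z := by
      have := congrArg (· + (W t : ℂ)) hae; simpa using this
    have haim : 0 ≤ a.im := by
      have := hA.isBoundedHull.subset_closure ha
      rwa [show upperHalfPlaneSet = {z : ℂ | 0 < z.im} from rfl, Complex.closure_setOf_lt_im] at this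
    rcases haim.lt_or_eq with hapos | hazero
    · have hadom : a ∈ domain W t := (mem_domain_iff W t a).2 ⟨hapos, haalive⟩
      exact hzA ((injOn_map hW t hadom hzdom heq) ▸ ha)
    · have ha' : a = (((a.re : ℝ)) : ℂ) := Complex.ext rfl (by rw [ofReal_im]; exact hazero.symm)
      rw [ha'] at haalive heq
      have hreal : (map W t (a.re : ℝ)).im = 0 := map_ofReal_im hW haalive
      rw [heq] at hreal
      exact absurd hreal (ne_of_gt (mapsTo_map hW t hzdom))
  rw [imageFlow_sub_imageDriver, starMap_eq hBt]
  exact hullExt_im_pos (Φ := starRMap _ hBt) ⟨hyH, hyB⟩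

/-! ### The Loewner equation (5.1) as a two-sided derivative -/

/-- Reading a function of alive times along `Real.toNNReal`: continuity within the alive times at
`t.toNNReal` (`β` alive) gives continuity within `[0, β]` at `t`. [folklore] -/
theorem continuousWithinAt_comp_toNNReal {X : Type*} [TopologicalSpace X] {φ : ℝ≥0 → X} {β : ℝ≥0}
    (hβ : Disjoint (closedHull W β) A) (t : ℝ)
    (hφ : ContinuousWithinAt φ {v | Disjoint (closedHull W v) A} t.toNNReal) :
    ContinuousWithinAt (fun r : ℝ ↦ φ r.toNNReal) (Icc (0 : ℝ) β) t := by
  refine hφ.comp continuous_real_toNNReal.continuousWithinAt fun r hr ↦ ?_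
  show Disjoint (closedHull W r.toNNReal) A
  refine alive_mono ?_ hβ
  rw [← NNReal.coe_le_coe, Real.coe_toNNReal r hr.1]
  exact hr.2

/-- **[LSW] (5.1): `∂_t g̃_t(ζ) = 2 h_t'(W_t)² / (g̃_t(ζ) − W̃_t)`**, as a two-sided derivative at
every time `s ∈ (0, β)` with `β` alive, for `z ∈ ℍ ∖ A` alive at `β`. The right derivative exists
at every alive time (`hasDerivWithinAt_imageFlow_Ici`) and is continuous in `t`
(`continuousWithinAt_starDeriv_slidHull`, `continuousWithinAt_imageFlow`,
`continuousWithinAt_imageDriver`), and `t ↦ g̃_t(ζ)` is continuous; by the fundamental theorem of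
calculus for right derivatives (`integral_eq_sub_of_hasDeriv_right_of_le`)
`g̃_t(ζ) = g̃_0(ζ) + ∫₀ᵗ 2 d_r²/(g̃_r(ζ) − W̃_r) dr`, whence the two-sided derivative.
[cite: LawlerSchrammWerner2003Restriction, §5 (5.1); Lawler2005, Prop. 4.40 and (4.34)] -/
theorem hasDerivAt_imageFlow (hW : Continuous W) (hA : IsStarHull A) (hne : A.Nonempty) {β : ℝ≥0}
    (hβ : Disjoint (closedHull W β) A) {z : ℂ} (hzH : 0 < z.im) (hzA : z ∉ A)
    (hzβ : (β : WithTop ℝ≥0) < swallowingTime W z) {s : ℝ} (hs0 : 0 < s) (hsβ : s < β) :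
    HasDerivAt (fun t : ℝ ↦ imageFlow W A t.toNNReal z)
      (2 * (starDeriv (slidHull W A s.toNNReal) : ℂ) ^ 2 /
        (imageFlow W A s.toNNReal z - imageDriver W A s.toNNReal)) s := by
  -- alive times and aliveness of `z` on `[0, β]`
  have halive : ∀ t : ℝ≥0, t ≤ β → Disjoint (closedHull W t) A := fun t ht ↦ alive_mono ht hβ
  have hzal : ∀ t : ℝ≥0, t ≤ β → (t : WithTop ℝ≥0) < swallowingTime W z := fun t ht ↦
    lt_of_le_of_lt (WithTop.coe_le_coe.2 ht) hzβ
  have hle : ∀ {t : ℝ}, t ∈ Icc (0 : ℝ) β → t.toNNReal ≤ β := fun ht ↦ by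
    rw [← NNReal.coe_le_coe, Real.coe_toNNReal _ ht.1]; exact ht.2
  set f : ℝ → ℂ := fun t ↦ imageFlow W A t.toNNReal z with hf
  set g : ℝ → ℂ := fun t ↦ 2 * (starDeriv (slidHull W A t.toNNReal) : ℂ) ^ 2 /
    (imageFlow W A t.toNNReal z - imageDriver W A t.toNNReal) with hg
  -- continuity of `f` and `g` on `[0, β]`
  have hfc : ContinuousOn f (Icc (0 : ℝ) β) := fun t ht ↦
    continuousWithinAt_comp_toNNReal hβ t
      (continuousWithinAt_imageFlow hW hA hne (halive _ (hle ht)) hzH hzA (hzal _ (hle ht)))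
  have hgc : ContinuousOn g (Icc (0 : ℝ) β) := by
    intro t ht
    have hd := continuousWithinAt_comp_toNNReal hβ t
      (continuousWithinAt_starDeriv_slidHull hW hA hne (halive _ (hle ht)))
    have hF := continuousWithinAt_comp_toNNReal hβ t
      (continuousWithinAt_imageFlow hW hA hne (halive _ (hle ht)) hzH hzA (hzal _ (hle ht)))
    have hD := continuousWithinAt_comp_toNNReal hβ t
      (continuousWithinAt_imageDriver hW hA hne (halive _ (hle ht)))
    have hne0 : imageFlow W A t.toNNReal z - (imageDriver W A t.toNNReal : ℂ) ≠ 0 := by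
      intro h0
      have := im_imageFlow_sub_imageDriver_pos hW hA (halive _ (hle ht)) hzH hzA (hzal _ (hle ht))
      rw [h0, zero_im] at this
      exact lt_irrefl _ this
    refine ((continuousWithinAt_const.mul ((Complex.continuous_ofReal.continuousWithinAt.comp hd
      (mapsTo_univ _ _)).pow 2)).div (hF.sub (Complex.continuous_ofReal.continuousWithinAt.comp hD
        (mapsTo_univ _ _))) hne0)
  -- right derivatives on `(0, β)`
  have hderiv : ∀ t ∈ Ioo (0 : ℝ) β, HasDerivWithinAt f (g t) (Ioi t) t := by
    intro t ht
    have ht' : t ∈ Icc (0 : ℝ) β := ⟨ht.1.le, ht.2.le⟩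
    have h := hasDerivWithinAt_imageFlow_Ici hW hA hne (halive _ (hle ht')) (z := z) hzH hzA (hzal _ (hle ht'))
    rw [Real.coe_toNNReal t ht.1.le] at h
    exact h.mono Ioi_subset_Ici_self
  -- FTC: `f u = f 0 + ∫₀ᵘ g` on `[0, β]`
  have hFTC : ∀ u ∈ Icc (0 : ℝ) β, f u = f 0 + ∫ r in (0 : ℝ)..u, g r := by
    intro u hu
    have h := intervalIntegral.integral_eq_sub_of_hasDeriv_right_of_le hu.1 (hfc.mono (Icc_subset_Icc_right hu.2))
      (fun t ht ↦ hderiv t ⟨ht.1, ht.2.trans_le hu.2⟩)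
      ((hgc.mono (Icc_subset_Icc_right hu.2)).intervalIntegrable_of_Icc hu.1)
    rw [h]; ring
  -- the integral has derivative `g s` at `s`
  have hsIoo : s ∈ Ioo (0 : ℝ) β := ⟨hs0, hsβ⟩
  have hgo : ContinuousOn g (Ioo (0 : ℝ) β) := hgc.mono Ioo_subset_Icc_self
  have hint : IntervalIntegrable g MeasureTheory.volume 0 s :=
    (hgc.mono (Icc_subset_Icc_right hsβ.le)).intervalIntegrable_of_Icc hs0.le
  have hI : HasDerivAt (fun u ↦ ∫ r in (0 : ℝ)..u, g r) (g s) s :=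
    intervalIntegral.integral_hasDerivAt_right hint (hgo.stronglyMeasurableAtFilter isOpen_Ioo s hsIoo)
      (hgo.continuousAt (isOpen_Ioo.mem_nhds hsIoo))
  have hI' : HasDerivAt (fun u ↦ f 0 + ∫ r in (0 : ℝ)..u, g r) (g s) s := hI.const_add _
  refine hI'.congr_of_eventuallyEq ?_
  filter_upwards [isOpen_Ioo.mem_nhds hsIoo] with u hu
  exact hFTC u ⟨hu.1.le, hu.2.le⟩

end Loewner

end Literature.Probability.RandomPlanarGeometry

end
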